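import Literature.Combinatorics.Optimization.PsdMinimalPolytopes
import HarnessLib

/-!
# Regular polygons: the sparse sum-of-squares certificate and the psd lift of size `2n − 1` of the
# regular `2^n`-gon (Fawzi–Saunderson–Parrilo, Prop. 8, Thm. 2, Thm. 3, §3.2) — PROVED

Source. H. Fawzi, J. Saunderson, P. A. Parrilo, *Equivariant semidefinite lifts of regular polygons*,
Math. Oper. Res. 42 (2017) 472–494 = arXiv:1409.4379 [FawziSaundersonParrilo2014] (held text
`paper:arxiv-1409.4379`; `pNN` = held-text chunk: §1.3 notation and Thms. 1–3 on p04–p05, §1.4 /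
Thm. 6 / Ex. 1 on p06–p07, §3 Prop. 8 with proof on p12, §3.1–3.2 on p12–p13).

Context (why it is in this topic). The survey H. Fawzi, J. Gouveia, P. A. Parrilo, R. Z. Robinson,
R. R. Thomas, *Positive semidefinite rank*, Math. Program. 153 (2015) [FawziEtAl2015], §5.2 Example 5.14
(held `paper:arxiv-1407.4095` p16): "let `S_d` be the slack matrix of a `d`-gon in the plane … `rank_psd(S_d)`
grows to infinity as `d` increases [Cor. 5.13, the tree's open fact `FawziEtAl2015_cor513`] … `rank(S_d) =
3` for all `d`", and §9.4 Problem 9.9 (gap between psd and LP lifts). Gouveia–Robinson–Thomas, *Worst-case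
results for positive semidefinite rank* (arXiv:1305.4600, §3, p07): "We know some `8`-gons with psd rank
four, but we have no idea how high their psd rank can be, apart from the trivial upper bound of six".
This file proves the UPPER side for regular polygons: **the regular `2^n`-gon has psd rank at most
`2n − 1 = 2 log₂ N − 1`** (while it has `N = 2^n` vertices, `rank S = 3`, and — the tree's
`IsConvexPolygon.four_le_of_hasPsdFactorization`, GRT 2013 Thm. 4.7 — psd rank `≥ 4` once `N ≥ 5`).

Contents (all statements are theorems; no named facts):

* **Proposition 8, eq. (sos)** (p12, verbatim): "`(cos(π/2^n) − cos θ)/sin(π/2^n) = Σ_{k=0}^{n−2}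
  (cos(2^k·π/2^n) − cos(2^k θ))² / (2^k sin(2^{k+1}·π/2^n)) − cos(2^{n−1}θ)/2^{n−1}` for all `n ≥ 1`
  and all `θ`": `FawziSaundersonParrilo2014_prop8` (and the multiplied form
  `RegularPolygon.sum_weight_mul_sq_level_sub_cos`). The printed proof is an induction on `n` through
  eq. (double); here the same telescoping is organised once and for all as the AFFINE identity
  `RegularPolygon.sum_weight_affine`: for every sequence `L`, `Σ_{k ≤ n−2} w_k (a_k² + ½ − 2a_k L_k +
  ½ L_{k+1}) = cos(π/2^n) − L_0 + (sin(π/2^n)/2^{n−1}) L_{n−1}`, where `a_k = cos(2^kπ/2^n)`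
  (`RegularPolygon.level`) and `w_k = sin(π/2^n)/(2^k sin(2^{k+1}π/2^n)) > 0` (`RegularPolygon.weight`,
  `weight_pos`); its four ingredients are `2w_0a_0 = 1`, `w_k/2 = 2w_{k+1}a_{k+1}`, `w_{n−2}/2 =
  sin(π/2^n)/2^{n−1}` and `Σ_k w_k(a_k² + ½) = cos(π/2^n)` (a cotangent telescoping). With
  `L_k = cos(2^kθ)` this is eq. (sos); with `L_k = cos(2^kψ)x_k + sin(2^kψ)y_k` it is the linear
  identity certifying the facet at angle `ψ` in Theorem 3.
* **Theorem 2 / Prop. 8 in `F(2^n, ℝ)`** (p05: "`ℓ = cos(π/2^n) − x` admits a sum-of-squares certificate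
  with frequencies in `K = {0} ∪ {2^i, i = 0, …, n−2}` … `ℓ = Σ_{k=0}^{n−2} h_k²`, `h_k ∈ TPol_0 ⊕
  TPol_{2^k}`", and "one automatically obtains a sum-of-squares certificate for all the other facets …
  by rotation"): on the vertices `θ_i = (2i+1)π/N` and for every facet `⟨(cos φ_j, sin φ_j), ·⟩ ≤ cos(π/N)`,
  `φ_j = 2jπ/N`, the slack is `S_{ij} = Σ_k w_k (a_k − cos(2^k(θ_i − φ_j)))²`
  (`RegularPolygon.slack_pow_two_eq_sum_sq`; the tail vanishes because `c_{2^{n−1}} = 0` on `X_{2^n}`,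
  `RegularPolygon.cos_pow_pred_mul_angle_sub`).
* **§3.2, the `S^{2n−1}_+`-lift** (p13: "`dim V = 2n − 1` … the regular `2^n`-gon admits the following
  equivariant psd lift of size `2n − 1`"): in matrix form `RegularPolygon.hasPsdFactorization_slack_pow_two`
  — the `N × N` slack matrix of the regular `2^n`-gon has a psd factorization of size `2n − 1`, with
  the rank-one moment factors `v(θ_i)v(θ_i)ᵀ`, `v(θ) = (1, cos 2^kθ, sin 2^kθ)_{k ≤ n−2}`
  (`RegularPolygon.momentVec`) and the Gram factors of the rotated certificate (`RegularPolygon.certVec`)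
  — and, through FGPRT Thm. 3.3 in the tree's polygon vocabulary (`IsConvexPolygon.hasPsdLift_iff`),
  as a psd LIFT: `FawziSaundersonParrilo2014_lift` (`conv X_{2^n} = π(S^{2n−1}_+ ∩ L)`, `n ≥ 2`) and
  `RegularPolygon.hasPsdLift_polygon` (same for the facet description). For this the regular `N`-gon
  is placed in the vocabulary of `PsdMinimalPolytopes.lean`: `RegularPolygon.isConvexPolygon_vertex`
  (`N ≥ 3`), `RegularPolygon.cross2_vertex` / `polygonSlack_vertex` (the edge `[x_j, x_{j+1}]` is the
  facet `j + 1`; `polygonSlack = 2 sin(π/N) ·` facet slack, columns shifted), and `H = V`: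
  `RegularPolygon.polygon_eq_convexHull`.
* **Theorem 3** (p05, verbatim): "The regular `2^n`-gon is the set of points `(x_0,y_0) ∈ ℝ²` such that
  there exist real numbers `x_1, y_1, …, x_{n−2}, y_{n−2}, y_{n−1}` satisfying `[1, x_{k−1}, y_{k−1};
  x_{k−1}, (1+x_k)/2, y_k/2; y_{k−1}, y_k/2, (1−x_k)/2] ∈ S^3_+` for `k = 1, …, n−2` and `[1, x_{n−2},
  y_{n−2}; x_{n−2}, ½, y_{n−1}/2; y_{n−2}, y_{n−1}/2, ½] ∈ S^3_+`": `FawziSaundersonParrilo2014_thm3`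
  (`conv X_{2^n} = fspLiftSet n`, `n ≥ 2`; `fspBlock`, `fspLiftSet` with the convention `x_{n−1} = 0`
  for the last block) and `RegularPolygon.polygon_eq_fspLiftSet`. Proof: `⊆` — the lifted set is
  convex (`convex_fspLiftSet`, the blocks are affine: `fspBlock_convex_comb`) and contains the vertices
  with their moments (`vertex_mem_fspLiftSet`, rank-one blocks `fspBlock_moment`); `⊇` — the affine
  identity paired with the psd blocks (`fspBlock_quadForm`, `fspLiftSet_subset_polygon`).
* Numbers: `RegularPolygon.regularOctagon_psdRank_bounds` (`4 ≤ rank_psd S_8 ≤ 5`),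
  `regularHexadecagon_psdRank_bounds` (`4 ≤ rank_psd S_16 ≤ 7`, the `7 × 7` matrix displayed on p13),
  `hasPsdLift_bounds` (`n ≥ 3`: a lift of size `2n − 1`, none of size `< 4`).

Deviations from print. The paper's vertices are `θ_i = (2i−1)π/N`, `i = 1..N`; here `i = 0..N−1` and
`θ_i = (2i+1)π/N` (the same set). The lift is obtained through the Gram/moment passage written out
(the paper's Thm. 6 cites [gouveia2010theta]); EQUIVARIANCE of the lifts (Def. 2, the point of the
paper's title) is not formalised — only existence and size. Prop. 8 is proved by a direct telescoping
rather than the printed induction on `n` (same identities (double)).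

NOT here: Theorem 1 (the theta-rank of the regular `N`-gon is exactly `⌈N/4⌉`, §2 and §6), Theorems
4–5 and §4 (structure theorem and the lower bound `|K| ≥ ln(N/2)/2` for sos-valid frequency sets, hence
equivariant psd lifts of size `Ω(log N)`), §7 / App. A (equivariant LP lifts of size `≥ N`), Ex. 1
(the hexagon's `S^4_+`-lift; the tree has `grtHexagonSlack_psdRank`: psd rank exactly `4`).
-/

noncomputable section

open Matrix Finset Real
open scoped MatrixOrder

namespace Literature.Combinatorics.Optimization

/-! ### The `3 × 3` moment blocks and their quadratic form (FSP Thm. 3 / §3.1) -/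

/-- **The `3 × 3` block of FSP Theorem 3** (p05, verbatim): "`[1, x_{k-1}, y_{k-1}; x_{k-1},
(1+x_k)/2, y_k/2; y_{k-1}, y_k/2, (1−x_k)/2] ∈ S^3_+`" — the moment matrix `M_{V_k}(z)` of the
`3`-dimensional invariant subspace `V_k = TPol_0 ⊕ TPol_{2^k}` in the basis `c_0, c_{2^k}, s_{2^k}`
(§3.1, p13), with `a = z(c_{2^{k}})`, `b = z(s_{2^k})`, `c = z(c_{2^{k+1}})`, `d = z(s_{2^{k+1}})`,
`z(c_0) = 1`. [cite: FawziSaundersonParrilo2014, Thm. 3 (p05) and §3.1 (p12–13)] -/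
def fspBlock (a b c d : ℝ) : Matrix (Fin 3) (Fin 3) ℝ :=
  !![1, a, b; a, (1 + c) / 2, d / 2; b, d / 2, (1 - c) / 2]

/-- `fspBlock` is symmetric. [cite: FawziSaundersonParrilo2014, §3.1 (p12)] -/
theorem fspBlock_isHermitian (a b c d : ℝ) : (fspBlock a b c d).IsHermitian := by
  rw [IsHermitian, conjTranspose_eq_transpose_of_trivial]
  ext i j; fin_cases i <;> fin_cases j <;> rfl

/-- `fspBlock` is affine in its arguments: a convex combination of blocks is the block of the convex
combination (the lifted set is convex). [cite: FawziSaundersonParrilo2014, Thm. 3 (p05)] -/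
theorem fspBlock_convex_comb (a b c d a' b' c' d' α β : ℝ) (h : α + β = 1) :
    α • fspBlock a b c d + β • fspBlock a' b' c' d' =
      fspBlock (α * a + β * a') (α * b + β * b') (α * c + β * c') (α * d + β * d') := by
  have hβ : β = 1 - α := by linarith
  subst hβ
  ext i j
  fin_cases i <;> fin_cases j <;> simp [fspBlock, smul_eq_mul] <;> ring

/-- **The quadratic form of a block against a "facet vector"** `q = (α, −cos ψ, −sin ψ)`:
`qᵀ B q = α² + ½ − 2α (cos ψ·a + sin ψ·b) + ½ (cos 2ψ·c + sin 2ψ·d)` — the trigonometric product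
formulae behind the moment maps (`c_k² = (c_0 + c_{2k})/2`, `c_k s_k = s_{2k}/2`, `s_k² = (c_0 −
c_{2k})/2`, p07/p13), read on the dual side. [cite: FawziSaundersonParrilo2014, §1.4 Ex. 1 (p07) and §3.1 (p12–13)] -/
theorem fspBlock_quadForm (a b c d α ψ : ℝ) :
    ![α, -cos ψ, -sin ψ] ⬝ᵥ (fspBlock a b c d *ᵥ ![α, -cos ψ, -sin ψ]) =
      α ^ 2 + 1 / 2 - 2 * α * (cos ψ * a + sin ψ * b) + (cos (2 * ψ) * c + sin (2 * ψ) * d) / 2 := by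
  simp [fspBlock, mulVec, dotProduct, Fin.sum_univ_three, cos_two_mul, sin_two_mul]
  linear_combination ((1 - c) / 2) * sin_sq_add_cos_sq ψ

/-- At a moment point the block is rank one: `fspBlock (cos t) (sin t) (cos 2t) (sin 2t) = v vᵀ`
with `v = (1, cos t, sin t)`. [cite: FawziSaundersonParrilo2014, §1.4 (p06–07, moment map)] -/
theorem fspBlock_moment (t : ℝ) :
    fspBlock (cos t) (sin t) (cos (2 * t)) (sin (2 * t)) =
      vecMulVec ![1, cos t, sin t] ![1, cos t, sin t] := by
  ext i j
  fin_cases i <;> fin_cases j <;> simp [fspBlock, vecMulVec_apply, cos_two_mul, sin_two_mul] <;>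
    nlinarith [sin_sq_add_cos_sq t]

/-- Hence the moment blocks are positive semidefinite. [cite: FawziSaundersonParrilo2014, §1.4 (p06–07)] -/
theorem posSemidef_fspBlock_moment (t : ℝ) :
    (fspBlock (cos t) (sin t) (cos (2 * t)) (sin (2 * t))).PosSemidef := by
  rw [fspBlock_moment]
  simpa using posSemidef_vecMulVec_self_star ![1, cos t, sin t]

/-! ### The tower of weights of Proposition 8 and its telescoping identities -/

namespace RegularPolygon

/-- The half central angle `π / 2^n` of the regular `2^n`-gon. [cite: FawziSaundersonParrilo2014, §1.3 (p04)] -/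
def halfAngle (n : ℕ) : ℝ := π / 2 ^ n

/-- The levels `a_k = cos(2^k · π/2^n)` of the certificate of Proposition 8.
[cite: FawziSaundersonParrilo2014, Prop. 8 (p12)] -/
def level (n k : ℕ) : ℝ := cos (2 ^ k * halfAngle n)

/-- The weights `w_k = sin(π/2^n) / (2^k sin(2^{k+1} · π/2^n))` of the certificate of Proposition 8.
[cite: FawziSaundersonParrilo2014, Prop. 8 (p12)] -/
def weight (n k : ℕ) : ℝ := sin (halfAngle n) / (2 ^ k * sin (2 ^ (k + 1) * halfAngle n))

/-- `π/2^n > 0`. [folklore] -/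
private theorem halfAngle_pos (n : ℕ) : 0 < halfAngle n := by
  unfold halfAngle; positivity

/-- `2^k · π/2^n ≤ π/2` for `k + 1 ≤ n`. [folklore] -/
private theorem pow_mul_halfAngle_le {n k : ℕ} (hk : k + 1 ≤ n) : 2 ^ k * halfAngle n ≤ π / 2 := by
  unfold halfAngle
  have h2 : (2:ℝ) ^ (k + 1) ≤ 2 ^ n := pow_le_pow_right₀ (by norm_num) hk
  rw [pow_succ] at h2
  have hpos : (0:ℝ) < 2 ^ n := by positivity
  rw [mul_div_assoc', div_le_iff₀ hpos]
  have := mul_le_mul_of_nonneg_left h2 pi_pos.le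
  linarith

/-- `π/2^n ≤ π/2` for `n ≥ 1`. [folklore] -/
private theorem halfAngle_le {n : ℕ} (hn : 1 ≤ n) : halfAngle n ≤ π / 2 := by
  simpa using pow_mul_halfAngle_le (n := n) (k := 0) hn

/-- `π/2^n < π` for `n ≥ 1`. [folklore] -/
private theorem halfAngle_lt_pi {n : ℕ} (hn : 1 ≤ n) : halfAngle n < π :=
  (halfAngle_le hn).trans_lt (by linarith [pi_pos])

/-- `2^k · π/2^n > 0`. [folklore] -/
private theorem pow_mul_halfAngle_pos (n k : ℕ) : 0 < 2 ^ k * halfAngle n :=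
  mul_pos (by positivity) (halfAngle_pos n)

/-- `2^{n-1} · π/2^n = π/2` (`n ≥ 1`). [cite: FawziSaundersonParrilo2014, §1.3 (p05, "c_{N/2} = 0")] -/
theorem pow_pred_mul_halfAngle {n : ℕ} (hn : 1 ≤ n) : 2 ^ (n - 1) * halfAngle n = π / 2 := by
  unfold halfAngle
  obtain ⟨m, rfl⟩ := Nat.exists_eq_add_of_le hn
  simp only [Nat.add_sub_cancel_left, pow_add, pow_one]
  field_simp

/-- `sin(π/2^n) > 0` for `n ≥ 1`. [folklore] -/
private theorem sin_halfAngle_pos {n : ℕ} (hn : 1 ≤ n) : 0 < sin (halfAngle n) :=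
  sin_pos_of_pos_of_lt_pi (halfAngle_pos n) (halfAngle_lt_pi hn)

/-- `sin(2^{k+1} · π/2^n) > 0` for `k + 2 ≤ n` (the weights are well defined and positive).
[cite: FawziSaundersonParrilo2014, Prop. 8 (p12)] -/
theorem sin_pow_succ_mul_halfAngle_pos {n k : ℕ} (hk : k + 2 ≤ n) :
    0 < sin (2 ^ (k + 1) * halfAngle n) :=
  sin_pos_of_pos_of_lt_pi (pow_mul_halfAngle_pos n (k + 1))
    ((pow_mul_halfAngle_le (by omega)).trans_lt (by linarith [pi_pos]))

/-- `cos(2^k · π/2^n) > 0` for `k + 2 ≤ n` (the angle is `≤ π/4`). [folklore] -/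
private theorem cos_pow_mul_halfAngle_pos {n k : ℕ} (hk : k + 2 ≤ n) : 0 < cos (2 ^ k * halfAngle n) := by
  refine cos_pos_of_mem_Ioo ⟨by linarith [pow_mul_halfAngle_pos n k, pi_pos], ?_⟩
  have h := pow_mul_halfAngle_le (n := n) (k := k + 1) (by omega)
  rw [pow_succ] at h
  linarith [pow_mul_halfAngle_pos n k]

/-- The weights are positive (`k ≤ n − 2`). [cite: FawziSaundersonParrilo2014, Prop. 8 (p12)] -/
theorem weight_pos {n k : ℕ} (hk : k + 2 ≤ n) : 0 < weight n k :=
  div_pos (sin_halfAngle_pos (by omega)) (mul_pos (by positivity) (sin_pow_succ_mul_halfAngle_pos hk))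

/-- `2^{k+1} s = 2 (2^k s)`. [folklore] -/
private theorem pow_succ_mul_halfAngle (n k : ℕ) : 2 ^ (k + 1) * halfAngle n = 2 * (2 ^ k * halfAngle n) := by
  ring

/-- First telescoping identity: `2 w_0 a_0 = 1` (`sin 2s = 2 sin s cos s`).
[cite: FawziSaundersonParrilo2014, Prop. 8 proof, eq. (double) (p12)] -/
theorem two_mul_weight_zero_mul_level_zero {n : ℕ} (hn : 2 ≤ n) :
    2 * weight n 0 * level n 0 = 1 := by
  have hs := (sin_halfAngle_pos (n := n) (by omega)).ne'
  have hc := (cos_pow_mul_halfAngle_pos (n := n) (k := 0) (by omega)).ne'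
  simp only [weight, level, pow_zero, one_mul, zero_add, pow_one] at hc ⊢
  rw [sin_two_mul]
  field_simp

/-- Second telescoping identity: `w_k / 2 = 2 w_{k+1} a_{k+1}` (`k + 3 ≤ n`).
[cite: FawziSaundersonParrilo2014, Prop. 8 proof (p12, induction step)] -/
theorem weight_div_two {n k : ℕ} (hk : k + 3 ≤ n) :
    weight n k / 2 = 2 * weight n (k + 1) * level n (k + 1) := by
  have hs := (sin_halfAngle_pos (n := n) (by omega)).ne'
  have hsx := (sin_pow_succ_mul_halfAngle_pos (n := n) (k := k) (by omega)).ne'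
  have hcx := (cos_pow_mul_halfAngle_pos (n := n) (k := k + 1) (by omega)).ne'
  simp only [weight, level]
  rw [pow_succ_mul_halfAngle n (k + 1), sin_two_mul]
  set y := 2 ^ (k + 1) * halfAngle n
  rw [pow_succ (2:ℝ) k]
  field_simp

/-- Third telescoping identity: the last weight, `w_{n-2} / 2 = sin(π/2^n) / 2^{n-1}` (`sin(π/2) = 1`).
[cite: FawziSaundersonParrilo2014, Prop. 8 (p12, the term `cos(2^{n-1}θ)/2^{n-1}`)] -/
theorem weight_last_div_two {n : ℕ} (hn : 2 ≤ n) :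
    weight n (n - 2) / 2 = sin (halfAngle n) / 2 ^ (n - 1) := by
  have h1 : n - 2 + 1 = n - 1 := by omega
  simp only [weight, h1, pow_pred_mul_halfAngle (show 1 ≤ n by omega), sin_pi_div_two, mul_one]
  obtain ⟨m, rfl⟩ := Nat.exists_eq_add_of_le hn
  simp only [Nat.add_sub_cancel_left, show 2 + m - 1 = m + 1 by omega, pow_succ]
  field_simp

/-- The cotangent tower `g_k = sin s · cos(2^k s) / (2^k sin(2^k s))`, `s = π/2^n`. [folklore] -/
private def cotTower (n k : ℕ) : ℝ :=
  sin (halfAngle n) * cos (2 ^ k * halfAngle n) / (2 ^ k * sin (2 ^ k * halfAngle n))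

/-- `w_k (a_k² + ½) = g_k − g_{k+1}` (`cot x − cot 2x = 1/sin 2x`). [folklore] -/
private theorem weight_mul_level_sq_add_half {n k : ℕ} (hk : k + 2 ≤ n) :
    weight n k * (level n k ^ 2 + 1 / 2) = cotTower n k - cotTower n (k + 1) := by
  have hsx : sin (2 ^ k * halfAngle n) ≠ 0 :=
    (sin_pos_of_pos_of_lt_pi (pow_mul_halfAngle_pos n k)
      ((pow_mul_halfAngle_le (by omega)).trans_lt (by linarith [pi_pos]))).ne'
  have hcx := (cos_pow_mul_halfAngle_pos hk).ne'
  simp only [weight, level, cotTower]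
  rw [pow_succ_mul_halfAngle, sin_two_mul, cos_two_mul, pow_succ]
  field_simp
  ring

/-- Fourth telescoping identity: `Σ_{k ≤ n-2} w_k (a_k² + ½) = cos(π/2^n)` (`n ≥ 1`).
[cite: FawziSaundersonParrilo2014, Prop. 8 (p12, constant terms)] -/
theorem sum_weight_mul_level_sq_add_half {n : ℕ} (hn : 1 ≤ n) :
    ∑ k ∈ Finset.range (n - 1), weight n k * (level n k ^ 2 + 1 / 2) = cos (halfAngle n) := by
  have hs := (sin_halfAngle_pos hn).ne'
  calc ∑ k ∈ Finset.range (n - 1), weight n k * (level n k ^ 2 + 1 / 2)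
      = ∑ k ∈ Finset.range (n - 1), (cotTower n k - cotTower n (k + 1)) :=
        Finset.sum_congr rfl fun k hk => weight_mul_level_sq_add_half (by
          have := Finset.mem_range.mp hk; omega)
    _ = cotTower n 0 - cotTower n (n - 1) := Finset.sum_range_sub' _ _
    _ = cos (halfAngle n) := by
        simp only [cotTower, pow_zero, one_mul, pow_pred_mul_halfAngle hn, cos_pi_div_two,
          mul_zero, zero_div, sub_zero]
        field_simp

/-- **The affine telescoping identity behind Proposition 8 / Theorem 3**: for every sequence `L`,
`Σ_{k ≤ n-2} w_k (a_k² + ½ − 2 a_k L_k + ½ L_{k+1}) = cos(π/2^n) − L_0 + (sin(π/2^n)/2^{n-1}) L_{n-1}`.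
(With `L_k = cos(2^k θ)` this is eq. (sos) of Prop. 8; with `L_k = cos(2^kψ) x_k + sin(2^kψ) y_k`
it is the linear identity certifying the facets in Theorem 3.) [cite: FawziSaundersonParrilo2014, Prop. 8 proof (p12)] -/
theorem sum_weight_affine {n : ℕ} (hn : 1 ≤ n) (L : ℕ → ℝ) :
    ∑ k ∈ Finset.range (n - 1),
        weight n k * (level n k ^ 2 + 1 / 2 - 2 * level n k * L k + L (k + 1) / 2) =
      cos (halfAngle n) - L 0 + sin (halfAngle n) / 2 ^ (n - 1) * L (n - 1) := by
  -- the coefficients `c_0 = 1`, `c_{k+1} = w_k / 2`, with `c_k = 2 w_k a_k` for `k ≤ n − 2`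
  let c : ℕ → ℝ := fun k => if k = 0 then 1 else weight n (k - 1) / 2
  have hc : ∀ k, k + 2 ≤ n → 2 * weight n k * level n k = c k := by
    intro k hk
    rcases k with _ | k
    · simp [c, two_mul_weight_zero_mul_level_zero hk]
    · simp only [c, Nat.succ_ne_zero, if_false, Nat.add_sub_cancel]
      exact (weight_div_two (by omega)).symm
  have hc' : ∀ k, weight n k / 2 = c (k + 1) := fun k => by simp [c]
  have hlast : c (n - 1) = sin (halfAngle n) / 2 ^ (n - 1) := by
    rcases Nat.lt_or_ge n 2 with h | h
    · have h1 : n = 1 := by omega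
      subst h1
      simp [c, halfAngle]
    · have : n - 1 ≠ 0 := by omega
      simp only [c, this, if_false, show n - 1 - 1 = n - 2 by omega]
      exact weight_last_div_two h
  have hsplit : ∀ k ∈ Finset.range (n - 1),
      weight n k * (level n k ^ 2 + 1 / 2 - 2 * level n k * L k + L (k + 1) / 2) =
        weight n k * (level n k ^ 2 + 1 / 2) + (c (k + 1) * L (k + 1) - c k * L k) := by
    intro k hk
    have hk' : k + 2 ≤ n := by have := Finset.mem_range.mp hk; omega
    rw [← hc k hk', ← hc' k]
    ring
  rw [Finset.sum_congr rfl hsplit, Finset.sum_add_distrib, sum_weight_mul_level_sq_add_half hn,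
    Finset.sum_range_sub (fun k => c k * L k), hlast]
  simp [c]
  ring

/-- **Proposition 8, eq. (sos), multiplied through by `sin(π/2^n)`**: for all `n ≥ 1` and all `θ`,
`Σ_{k ≤ n-2} w_k (cos(2^k π/2^n) − cos(2^k θ))² = cos(π/2^n) − cos θ + (sin(π/2^n)/2^{n-1}) cos(2^{n-1}θ)`.
[cite: FawziSaundersonParrilo2014, Prop. 8, eq. (sos) (p12)] -/
theorem sum_weight_mul_sq_level_sub_cos {n : ℕ} (hn : 1 ≤ n) (θ : ℝ) :
    ∑ k ∈ Finset.range (n - 1), weight n k * (level n k - cos (2 ^ k * θ)) ^ 2 =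
      cos (halfAngle n) - cos θ + sin (halfAngle n) / 2 ^ (n - 1) * cos (2 ^ (n - 1) * θ) := by
  have h := sum_weight_affine hn (fun k => cos (2 ^ k * θ))
  simp only [pow_zero, one_mul] at h
  rw [← h]
  refine Finset.sum_congr rfl fun k _ => ?_
  congr 1
  have : cos (2 ^ (k + 1) * θ) = 2 * cos (2 ^ k * θ) ^ 2 - 1 := by
    rw [pow_succ, show (2:ℝ) ^ k * 2 * θ = 2 * (2 ^ k * θ) by ring, cos_two_mul]
  rw [this]
  ring

end RegularPolygon

/-- **FSP Proposition 8, the trigonometric identity (eq. (sos))** (p12, verbatim): "`(cos(π/2^n) −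
cos θ)/sin(π/2^n) = Σ_{k=0}^{n−2} (cos(2^k·π/2^n) − cos(2^k θ))² / (2^k sin(2^{k+1}·π/2^n)) −
cos(2^{n−1}θ)/2^{n−1}` for all `n ≥ 1` and all `θ`" — proved by the telescoping of eq. (double)
`(cos(π/N) − cos θ)/sin(π/N) = (cos(π/N) − cos θ)²/sin(2π/N) + ½ (cos(2π/N) − cos 2θ)/sin(2π/N)`.
[cite: FawziSaundersonParrilo2014, Prop. 8, eq. (sos) (p12)] -/
theorem FawziSaundersonParrilo2014_prop8 {n : ℕ} (hn : 1 ≤ n) (θ : ℝ) :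
    (cos (π / 2 ^ n) - cos θ) / sin (π / 2 ^ n) =
      ∑ k ∈ Finset.range (n - 1),
          (cos (2 ^ k * (π / 2 ^ n)) - cos (2 ^ k * θ)) ^ 2 / (2 ^ k * sin (2 ^ (k + 1) * (π / 2 ^ n)))
        - cos (2 ^ (n - 1) * θ) / 2 ^ (n - 1) := by
  have hs := (RegularPolygon.sin_halfAngle_pos hn).ne'
  have h := RegularPolygon.sum_weight_mul_sq_level_sub_cos hn θ
  have h' : ∑ k ∈ Finset.range (n - 1),
      (cos (2 ^ k * (π / 2 ^ n)) - cos (2 ^ k * θ)) ^ 2 / (2 ^ k * sin (2 ^ (k + 1) * (π / 2 ^ n))) =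
      (cos (π / 2 ^ n) - cos θ) / sin (π / 2 ^ n) + cos (2 ^ (n - 1) * θ) / 2 ^ (n - 1) := by
    have h2 := congrArg (fun t => t / sin (RegularPolygon.halfAngle n)) h
    simp only [Finset.sum_div] at h2
    simp only [RegularPolygon.halfAngle] at h2 hs ⊢
    convert h2 using 1
    · refine Finset.sum_congr rfl fun k hk => ?_
      have hk' : k + 2 ≤ n := by have := Finset.mem_range.mp hk; omega
      have hy := (RegularPolygon.sin_pow_succ_mul_halfAngle_pos hk').ne'
      simp only [RegularPolygon.weight, RegularPolygon.level, RegularPolygon.halfAngle] at hy ⊢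
      field_simp
    · field_simp
  rw [h']
  ring

namespace RegularPolygon

/-! ### The regular `N`-gon: vertices, facet normals, slack matrix -/

variable {N : ℕ}

/-- The vertex angles `θ_i = (2i−1)π/N`, `i = 1..N` (here `i = 0..N−1`, `θ_i = (2i+1)π/N`).
[cite: FawziSaundersonParrilo2014, §1.3 (p04)] -/
def vertexAngle (N : ℕ) (i : Fin N) : ℝ := (2 * (i : ℝ) + 1) * π / N

/-- The facet angles `φ_j = 2jπ/N`: the `j`-th facet is `cos φ_j · x + sin φ_j · y ≤ cos(π/N)`, the
rotations of the "first" facet `x ≤ cos(π/N)`. [cite: FawziSaundersonParrilo2014, §1.3 (p04, eq. (facetineq))] -/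
def facetAngle (N : ℕ) (j : Fin N) : ℝ := 2 * (j : ℝ) * π / N

/-- The vertices `X_N = {(cos θ_i, sin θ_i)}` of the regular `N`-gon. [cite: FawziSaundersonParrilo2014, §1.3 (p04)] -/
def vertex (N : ℕ) (i : Fin N) : Fin 2 → ℝ := ![cos (vertexAngle N i), sin (vertexAngle N i)]

/-- The outer unit normals `(cos φ_j, sin φ_j)` of the facets of the regular `N`-gon.
[cite: FawziSaundersonParrilo2014, §1.3 (p04, eq. (facetineq))] -/
def normal (N : ℕ) (j : Fin N) : Fin 2 → ℝ := ![cos (facetAngle N j), sin (facetAngle N j)]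

/-- **The slack matrix of the regular `N`-gon**: `S_{ij} = cos(π/N) − ⟨u_j, x_i⟩`, the slack of the
vertex `x_i` in the facet inequality `⟨u_j, ·⟩ ≤ cos(π/N)` (`ℓ = cos(π/N) c_0 − c_1` and its
rotations, evaluated on `X_N`). [cite: FawziSaundersonParrilo2014, §1.3 (p04–05)] -/
def slack (N : ℕ) : Matrix (Fin N) (Fin N) ℝ :=
  Matrix.of fun i j => cos (π / N) - normal N j ⬝ᵥ vertex N i

/-- The regular `N`-gon by its facets: `{p : ⟨u_j, p⟩ ≤ cos(π/N) ∀ j}`.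
[cite: FawziSaundersonParrilo2014, §1.3 (p04, eq. (facetineq))] -/
def polygon (N : ℕ) : Set (Fin 2 → ℝ) := {p | ∀ j : Fin N, normal N j ⬝ᵥ p ≤ cos (π / N)}

/-- `⟨u_j, p⟩ = cos φ_j · p_0 + sin φ_j · p_1`. [cite: FawziSaundersonParrilo2014, §1.3 (p04, eq. (facetineq))] -/
theorem normal_dotProduct (j : Fin N) (p : Fin 2 → ℝ) :
    normal N j ⬝ᵥ p = cos (facetAngle N j) * p 0 + sin (facetAngle N j) * p 1 := by
  simp [normal, dotProduct, Fin.sum_univ_two]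

/-- `S_{ij} = cos(π/N) − cos(θ_i − φ_j)`. [cite: FawziSaundersonParrilo2014, §1.3 (p05, "`c_k(θ) = cos(kθ)`")] -/
theorem slack_apply (i j : Fin N) :
    slack N i j = cos (π / N) - cos (vertexAngle N i - facetAngle N j) := by
  rw [slack, Matrix.of_apply, normal_dotProduct, cos_sub]
  simp [vertex]
  ring

/-- `π / 2^n` is the half angle. [folklore] -/
private theorem pi_div_pow_two (n : ℕ) : π / ((2 ^ n : ℕ) : ℝ) = halfAngle n := by
  simp [halfAngle]

/-- On the `2^n`-gon, `c_{2^{n-1}} = 0`: `cos(2^{n-1}(θ_i − φ_j)) = cos((i − j)π + π/2) = 0`.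
[cite: FawziSaundersonParrilo2014, §1.3 (p05, "when `N` is even, `c_{N/2} = 0`")] -/
theorem cos_pow_pred_mul_angle_sub {n : ℕ} (hn : 1 ≤ n) (i j : Fin (2 ^ n)) :
    cos (2 ^ (n - 1) * (vertexAngle (2 ^ n) i - facetAngle (2 ^ n) j)) = 0 := by
  have h2 : (2:ℝ) ^ n = 2 * 2 ^ (n - 1) := by
    obtain ⟨m, rfl⟩ := Nat.exists_eq_add_of_le hn
    simp [pow_add]
  have hne : (2:ℝ) ^ (n - 1) ≠ 0 := by positivity
  have harg : 2 ^ (n - 1) * (vertexAngle (2 ^ n) i - facetAngle (2 ^ n) j) =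
      (((i : ℤ) - (j : ℤ) : ℤ) : ℝ) * π + π / 2 := by
    simp only [vertexAngle, facetAngle, Nat.cast_pow, Nat.cast_ofNat, h2]
    push_cast
    field_simp
    ring
  rw [harg, cos_add_pi_div_two, sin_int_mul_pi, neg_zero]

/-- **FSP Theorem 2 / Proposition 8 in `F(2^n, ℝ)`, for every facet** (p05: "`ℓ` admits a
sum-of-squares certificate with frequencies in `K = {0} ∪ {2^i, i = 0..n−2}` … there exist `h_k ∈
TPol_0(2^n) ⊕ TPol_{2^k}(2^n)` … `ℓ = Σ_{k=0}^{n−2} h_k²`"; p12: "`ℓ = Σ_k sin(π/2^n)/(2^k sin(2^{k+1}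
π/2^n)) (cos(2^k π/2^n) c_0 − c_{2^k})²`", and p05 "one automatically obtains a sum-of-squares
certificate for all the other facets … by rotation"): on the vertices of the regular `2^n`-gon,
`S_{ij} = Σ_{k ≤ n−2} w_k (cos(2^kπ/2^n) − cos(2^k(θ_i − φ_j)))²`. [cite: FawziSaundersonParrilo2014, Thm. 2 (p05) and Prop. 8 (p12)] -/
theorem slack_pow_two_eq_sum_sq {n : ℕ} (hn : 1 ≤ n) (i j : Fin (2 ^ n)) :
    slack (2 ^ n) i j = ∑ k ∈ Finset.range (n - 1),
      weight n k * (level n k - cos (2 ^ k * (vertexAngle (2 ^ n) i - facetAngle (2 ^ n) j))) ^ 2 := by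
  rw [sum_weight_mul_sq_level_sub_cos hn, cos_pow_pred_mul_angle_sub hn, mul_zero, add_zero,
    slack_apply, pi_div_pow_two]


/-! ### The psd factorization of size `2n − 1` (FSP §3.2: the `S^{2n-1}_+`-lift) -/

/-- Gram bridge: `M_{ij} = Σ_s ⟨b_i, a_{j,s}⟩²` gives the psd factorization `A_i = b_i b_iᵀ`,
`B_j = Σ_s a_{j,s} a_{j,s}ᵀ` of size `#τ` (the moment map / Gram matrix passage of Thm. 6).
[cite: FawziSaundersonParrilo2014, §1.4 Thm. 6 (p06–07)] -/
private theorem hasPsdFactorization_of_gram {ι κ τ : Type*} [Fintype τ]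
    {M : ι → κ → ℝ} (b : ι → τ → ℝ) (m : ℕ) (a : κ → Fin m → τ → ℝ)
    (hM : ∀ i j, M i j = ∑ s : Fin m, (∑ t, b i t * a j s t) ^ 2) :
    HasPsdFactorization M (Fintype.card τ) := by
  classical
  let e : τ ≃ Fin (Fintype.card τ) := Fintype.equivFin τ
  let b' : ι → Fin (Fintype.card τ) → ℝ := fun i l => b i (e.symm l)
  let a' : κ → Fin m → Fin (Fintype.card τ) → ℝ := fun j s l => a j s (e.symm l)
  refine ⟨fun i => vecMulVec (b' i) (b' i), fun j => ∑ s, vecMulVec (a' j s) (a' j s),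
    fun i => by simpa using posSemidef_vecMulVec_self_star (b' i),
    fun j => posSemidef_sum _ fun s _ => by simpa using posSemidef_vecMulVec_self_star (a' j s),
    fun i j => ?_⟩
  rw [hM i j, Finset.mul_sum, trace_sum]
  refine Finset.sum_congr rfl fun s _ => ?_
  have h1 : b' i ⬝ᵥ a' j s = ∑ t, b i t * a j s t := by
    simp only [dotProduct, b', a']
    exact e.symm.sum_comp (fun t => b i t * a j s t)
  rw [vecMulVec_mul_vecMulVec, trace_vecMulVec, dotProduct_smul, smul_eq_mul, h1, sq]

/-- The row vectors of the factorization: the moment vector of the vertex `θ_i` in the basis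
`c_0, (c_{2^k}, s_{2^k})_{k ≤ n-2}` of `V = TPol_0 ⊕ ⊕_k TPol_{2^k}` (`dim V = 2n − 1`).
[cite: FawziSaundersonParrilo2014, §3.2 (p13)] -/
def momentVec (n : ℕ) (θ : ℝ) : Option (Fin (n - 1) × Fin 2) → ℝ
  | none => 1
  | some (k, l) => ![cos (2 ^ (k : ℕ) * θ), sin (2 ^ (k : ℕ) * θ)] l

/-- The column vectors of the factorization: the coefficient vector of `√w_k (cos(2^kπ/2^n) c_0 −
(cos(2^kφ) c_{2^k} + sin(2^kφ) s_{2^k}))`, the rotation by `φ` of the `k`-th square of Prop. 8.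
[cite: FawziSaundersonParrilo2014, §3.2 (p13) and Prop. 8 (p12)] -/
def certVec (n : ℕ) (φ : ℝ) (s : Fin (n - 1)) : Option (Fin (n - 1) × Fin 2) → ℝ
  | none => √(weight n s) * level n s
  | some (k, l) => if k = s then -(√(weight n s) * ![cos (2 ^ (s : ℕ) * φ), sin (2 ^ (s : ℕ) * φ)] l) else 0

/-- `⟨momentVec θ, certVec φ s⟩ = √w_s (a_s − cos(2^s(θ − φ)))`. [cite: FawziSaundersonParrilo2014, §3.2 (p13)] -/
theorem momentVec_dot_certVec (n : ℕ) (θ φ : ℝ) (s : Fin (n - 1)) :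
    ∑ t, momentVec n θ t * certVec n φ s t = √(weight n s) * (level n s - cos (2 ^ (s : ℕ) * (θ - φ))) := by
  rw [Fintype.sum_option, Fintype.sum_prod_type]
  simp only [momentVec, certVec, Fin.sum_univ_two, Matrix.cons_val_zero, Matrix.cons_val_one]
  have : ∀ k : Fin (n - 1), (cos (2 ^ (k:ℕ) * θ) * (if k = s then -(√(weight n s) * cos (2 ^ (s:ℕ) * φ)) else 0) +
      sin (2 ^ (k:ℕ) * θ) * (if k = s then -(√(weight n s) * sin (2 ^ (s:ℕ) * φ)) else 0)) =
      if k = s then -(√(weight n s) * (cos (2 ^ (s:ℕ) * θ) * cos (2 ^ (s:ℕ) * φ) +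
        sin (2 ^ (s:ℕ) * θ) * sin (2 ^ (s:ℕ) * φ))) else 0 := by
    intro k
    split_ifs with h
    · subst h; ring
    · ring
  rw [Finset.sum_congr rfl fun k _ => this k, Finset.sum_ite_eq' Finset.univ s]
  simp only [Finset.mem_univ, if_true, mul_sub, cos_sub, one_mul]
  ring

/-- `#(Option (Fin (n−1) × Fin 2)) = 2n − 1` (`n ≥ 1`). [cite: FawziSaundersonParrilo2014, §3.2 (p13, "`dim V = 2n−1`")] -/
theorem card_index {n : ℕ} (hn : 1 ≤ n) : Fintype.card (Option (Fin (n - 1) × Fin 2)) = 2 * n - 1 := by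
  simp only [Fintype.card_option, Fintype.card_prod, Fintype.card_fin]
  omega

/-- **The slack matrix of the regular `2^n`-gon has a psd factorization of size `2n − 1`** (FSP
§3.2, p13: "`dim V = 2n−1` … the regular `2^n`-gon admits the following equivariant psd lift of size
`2n−1`"; here the matrix form, through the certificate of Prop. 8 rotated to every facet and the
Gram/moment passage of Thm. 6): `rank_psd S_{2^n-gon} ≤ 2n − 1` (`n ≥ 1`). So the psd rank of the
regular `N`-gon, `N = 2^n`, is `O(log N)` while `rank S = 3` — cf. FGPRT Ex. 5.14 (`rank_psd(S_d) →
∞` for `d`-gons, `FawziEtAl2015_cor513`). Equivariance of the lift is not recorded here.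
[cite: FawziSaundersonParrilo2014, §3.2 (p13)] -/
theorem hasPsdFactorization_slack_pow_two {n : ℕ} (hn : 1 ≤ n) :
    HasPsdFactorization (slack (2 ^ n)) (2 * n - 1) := by
  rw [← card_index hn]
  refine hasPsdFactorization_of_gram (fun i => momentVec n (vertexAngle (2 ^ n) i)) (n - 1)
    (fun j s => certVec n (facetAngle (2 ^ n) j) s) fun i j => ?_
  rw [slack_pow_two_eq_sum_sq hn, Finset.sum_range]
  refine Finset.sum_congr rfl fun s _ => ?_
  rw [momentVec_dot_certVec, mul_pow, Real.sq_sqrt (weight_pos (by omega)).le]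

/-- Rank form: every `n ≥ 1` gives `rank_psd(S_{2^n}) ≤ 2n − 1`, e.g. the regular octagon has psd
rank `≤ 5` and the regular `16`-gon `≤ 7` (the `7 × 7` matrix displayed on p13).
[cite: FawziSaundersonParrilo2014, §3.2 (p13)] -/
theorem hasPsdFactorization_slack_pow_two_of_le {n k : ℕ} (hn : 1 ≤ n) (hk : 2 * n - 1 ≤ k) :
    HasPsdFactorization (slack (2 ^ n)) k :=
  (hasPsdFactorization_slack_pow_two hn).mono hk


/-! ### The regular `N`-gon in the polygon vocabulary of `PsdMinimalPolytopes` -/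

section Geometry

variable [NeZero N]

/-- Index bookkeeping: `((j + 1 : Fin N) : ℕ) = j + 1 − N·b` with `b = (j+1)/N ∈ {0, 1}`. [folklore] -/
private theorem val_add_one_real (j : Fin N) :
    ∃ b : ℕ, (((j + 1 : Fin N) : ℕ) : ℝ) = (j : ℝ) + 1 - (N : ℝ) * b := by
  refine ⟨(j.val + 1) / N, ?_⟩
  have h1 : ((j + 1 : Fin N) : ℕ) = (j.val + 1) % N := by
    rw [Fin.val_add, Fin.val_one', Nat.add_mod_mod]
  have h2 := Nat.div_add_mod (j.val + 1) N
  rw [h1]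
  have h3 : (((j.val + 1) % N : ℕ) : ℝ) = ((j.val + 1 : ℕ) : ℝ) - (N : ℝ) * ((j.val + 1) / N : ℕ) := by
    rw [eq_sub_iff_add_eq, ← Nat.cast_mul, ← Nat.cast_add, add_comm, h2]
  rw [h3]
  push_cast
  ring

/-- The next vertex angle is the current one plus the central angle `2π/N`, up to a multiple of `2π`
(wrap-around at `j = N − 1`). [cite: FawziSaundersonParrilo2014, §1.3 (p04)] -/
theorem vertexAngle_add_one (j : Fin N) : ∃ b : ℕ,
    vertexAngle N (j + 1) = vertexAngle N j + 2 * (π / N) - b * (2 * π) ∧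
    facetAngle N (j + 1) = vertexAngle N j + π / N - b * (2 * π) := by
  obtain ⟨b, hb⟩ := val_add_one_real j
  have hN : (N : ℝ) ≠ 0 := Nat.cast_ne_zero.mpr (NeZero.ne N)
  refine ⟨b, ?_, ?_⟩
  · simp only [vertexAngle, hb]
    field_simp
    ring
  · simp only [facetAngle, vertexAngle, hb]
    field_simp
    ring

/-- **The edge inequalities of the regular `N`-gon are its facet inequalities**: for every `y ∈ ℝ²`,
`det(x_{j+1} − x_j, y − x_j) = 2 sin(π/N) · (cos(π/N) − ⟨u_{j+1}, y⟩)` — the edge `[x_j, x_{j+1}]`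
of the vertex list lies on the facet `⟨u_{j+1}, ·⟩ ≤ cos(π/N)`. [cite: FawziSaundersonParrilo2014, §1.3 (p04, eq. (facetineq))] -/
theorem cross2_vertex (j : Fin N) (y : Fin 2 → ℝ) :
    cross2 (vertex N (j + 1) - vertex N j) (y - vertex N j) =
      2 * sin (π / N) * (cos (π / N) - normal N (j + 1) ⬝ᵥ y) := by
  obtain ⟨b, hθ, hφ⟩ := vertexAngle_add_one j
  rw [normal_dotProduct]
  simp only [cross2, vertex, Pi.sub_apply, Matrix.cons_val_zero, Matrix.cons_val_one, hθ, hφ,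
    cos_sub_nat_mul_two_pi, sin_sub_nat_mul_two_pi]
  set h := π / N
  set C := vertexAngle N j + h with hC
  have hA : vertexAngle N j = C - h := by rw [hC]; ring
  rw [show vertexAngle N j + 2 * h = C + h by rw [hC]; ring, hA]
  simp only [cos_add, cos_sub, sin_add, sin_sub]
  linear_combination (2 * sin h * cos h) * sin_sq_add_cos_sq C

/-- **The vertex/edge slack matrix of the regular `N`-gon is its facet slack matrix** up to the
positive factor `2 sin(π/N)` and the cyclic shift of the columns (`polygonSlack` indexes the edge
`[x_j, x_{j+1}]`, which is the facet `j + 1`). [cite: FawziSaundersonParrilo2014, §1.3 (p04–05)] -/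
theorem polygonSlack_vertex (i j : Fin N) :
    polygonSlack (vertex N) i j = 2 * sin (π / N) * slack N i (j + 1) := by
  rw [polygonSlack, Matrix.of_apply, cross2_vertex, slack, Matrix.of_apply]

/-- The angle `θ_i − φ_{j+1}` is `(2r − 1)π/N` modulo `2π`, where `r = i − j (mod N)`. [folklore] -/
private theorem vertexAngle_sub_facetAngle_add_one (i j : Fin N) : ∃ m : ℤ,
    vertexAngle N i - facetAngle N (j + 1) =
      (2 * (((i - j : Fin N) : ℕ) : ℝ) - 1) * (π / N) + m * (2 * π) := by
  obtain ⟨b, hb⟩ := val_add_one_real j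
  have hN : (N : ℝ) ≠ 0 := Nat.cast_ne_zero.mpr (NeZero.ne N)
  set r : ℕ := ((i - j : Fin N) : ℕ) with hr
  -- `(j + r) % N = i`
  have hjr : (j.val + r) % N = i.val := by
    have h := congrArg Fin.val (sub_add_cancel i j)
    rw [add_comm] at h
    rw [← h, Fin.val_add]
  have hdm := Nat.div_add_mod (j.val + r) N
  rw [hjr] at hdm
  -- `i = j + r − N a`
  have hi : ((i : ℕ) : ℝ) = (j : ℝ) + r - (N : ℝ) * ((j.val + r) / N : ℕ) := by
    rw [eq_sub_iff_add_eq, ← Nat.cast_mul]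
    have : ((N * ((j.val + r) / N) : ℕ) : ℝ) + ((i : ℕ) : ℝ) = (((j.val + r) : ℕ) : ℝ) := by
      rw [← Nat.cast_add, hdm]
    push_cast at this ⊢
    linarith
  obtain ⟨a, ha⟩ : ∃ a : ℕ, ((i : ℕ) : ℝ) = (j : ℝ) + r - (N : ℝ) * a := ⟨_, hi⟩
  refine ⟨(b : ℤ) - a, ?_⟩
  simp only [vertexAngle, facetAngle, hb, ha]
  push_cast
  field_simp
  ring

omit [NeZero N] in
/-- For `2 ≤ r ≤ N − 1`: `cos((2r−1)π/N) < cos(π/N)`. [folklore] -/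
private theorem cos_lt_cos_pi_div {r : ℕ} (hN : 3 ≤ N) (h2 : 2 ≤ r) (hr : r + 1 ≤ N) :
    cos ((2 * (r : ℝ) - 1) * (π / N)) < cos (π / N) := by
  have hNpos : (0 : ℝ) < N := by exact_mod_cast (show 0 < N by omega)
  have hh : 0 < π / N := div_pos pi_pos hNpos
  have hNh : (N : ℝ) * (π / N) = π := by field_simp
  have h3 : 3 * (π / N) ≤ (2 * (r : ℝ) - 1) * (π / N) := by
    gcongr
    have : (2:ℝ) ≤ r := by exact_mod_cast h2
    linarith
  have hup : (2 * (r : ℝ) - 1) * (π / N) ≤ 2 * π - 3 * (π / N) := by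
    have : (r : ℝ) + 1 ≤ N := by exact_mod_cast hr
    nlinarith
  have hπN : π / N ≤ π / 3 :=
    div_le_div_of_nonneg_left pi_pos.le (by norm_num) (by exact_mod_cast hN)
  set x := (2 * (r : ℝ) - 1) * (π / N)
  rcases le_or_gt x π with hx | hx
  · exact Real.strictAntiOn_cos ⟨hh.le, by linarith⟩ ⟨by linarith, hx⟩ (by linarith)
  · rw [← Real.cos_two_pi_sub]
    exact Real.strictAntiOn_cos ⟨hh.le, by linarith⟩ ⟨by linarith, by linarith⟩ (by linarith)

/-- **The regular `N`-gon (`N ≥ 3`) is a convex polygon** in the sense of `IsConvexPolygon`: its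
vertex list is in counterclockwise strictly convex position. [cite: FawziSaundersonParrilo2014, §1.3 (p04, Figure (fig:Ngon))] -/
theorem isConvexPolygon_vertex (hN : 3 ≤ N) : IsConvexPolygon (vertex N) := by
  intro i j hij hij1
  obtain ⟨m, hm⟩ := vertexAngle_sub_facetAngle_add_one i j
  have hNpos : (0 : ℝ) < N := by exact_mod_cast (show 0 < N by omega)
  have h3 : (3:ℝ) ≤ N := by exact_mod_cast hN
  have hsin : 0 < sin (π / N) :=
    sin_pos_of_pos_of_lt_pi (div_pos pi_pos hNpos) (by rw [div_lt_iff₀ hNpos]; nlinarith [pi_pos])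
  rw [polygonSlack_vertex, slack_apply, hm, cos_add_int_mul_two_pi]
  refine mul_pos (mul_pos two_pos hsin) (sub_pos.mpr (cos_lt_cos_pi_div hN ?_ ?_))
  · -- `r ≠ 0, 1`
    by_contra hlt
    have hr : ((i - j : Fin N) : ℕ) = 0 ∨ ((i - j : Fin N) : ℕ) = 1 := by omega
    rcases hr with h0 | h1
    · exact hij (sub_eq_zero.mp (Fin.ext h0))
    · apply hij1
      have : (i - j : Fin N) = 1 := Fin.ext (by rw [h1, Fin.val_one', Nat.mod_eq_of_lt (by omega)])
      exact sub_eq_iff_eq_add'.mp this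
  · exact (i - j : Fin N).isLt

/-- **`H = V` for the regular `N`-gon** (`N ≥ 3`): `{p : ⟨u_j, p⟩ ≤ cos(π/N) ∀ j} = conv X_N` (the
tree's `IsConvexPolygon.convexHull_eq` and `cross2_vertex`). [cite: FawziSaundersonParrilo2014, §1.3 (p04)] -/
theorem polygon_eq_convexHull (hN : 3 ≤ N) : polygon N = convexHull ℝ (Set.range (vertex N)) := by
  have hNpos : (0 : ℝ) < N := by exact_mod_cast (show 0 < N by omega)
  have h3 : (3:ℝ) ≤ N := by exact_mod_cast hN
  have hsin : 0 < sin (π / N) :=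
    sin_pos_of_pos_of_lt_pi (div_pos pi_pos hNpos) (by rw [div_lt_iff₀ hNpos]; nlinarith [pi_pos])
  rw [(isConvexPolygon_vertex hN).convexHull_eq hN]
  ext y
  simp only [polygon, Set.mem_setOf_eq]
  have key : ∀ j : Fin N, polygonNormal (vertex N) j ⬝ᵥ y ≤ polygonOffset (vertex N) j ↔
      normal N (j + 1) ⬝ᵥ y ≤ cos (π / N) := by
    intro j
    rw [← sub_nonneg, polygonOffset_sub_dotProduct, cross2_vertex, mul_nonneg_iff_of_pos_left
      (mul_pos two_pos hsin), sub_nonneg]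
  simp only [key]
  constructor
  · intro h j
    exact h (j + 1)
  · intro h j
    have h' := h (j - 1)
    rwa [sub_add_cancel] at h'

end Geometry


/-! ### Psd lifts of the regular `2^n`-gon of size `2n − 1`, and the octagon -/

section Lifts

/-- The vertex/edge slack matrix `polygonSlack` of the regular `2^n`-gon has a psd factorization of
size `2n − 1` (column shift and the factor `2 sin(π/2^n)` do not matter, FGPRT Thm. 2.9 (ii)).
[cite: FawziSaundersonParrilo2014, §3.2 (p13)] -/
theorem hasPsdFactorization_polygonSlack_vertex {n : ℕ} (hn : 1 ≤ n) :
    HasPsdFactorization (polygonSlack (vertex (2 ^ n))) (2 * n - 1) := by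
  have h := ((hasPsdFactorization_slack_pow_two hn).submatrix id (fun j : Fin (2 ^ n) => j + 1)).rescale
    (c := fun _ => 2 * sin (π / (2 ^ n : ℕ))) (d := fun _ => 1)
    (fun _ => mul_nonneg zero_le_two (sin_halfAngle_pos hn).le |>.trans_eq (by rw [pi_div_pow_two]))
    (fun _ => zero_le_one)
  convert h using 1
  funext i j
  rw [polygonSlack_vertex, mul_one, id]

/-- **The regular `2^n`-gon has a psd lift of size `2n − 1`** (FSP §3.2, p13: "the regular `2^n`-gon
admits the following equivariant psd lift of size `2n − 1`: `conv(X_{2^n}) = {(z(c_1), z(s_1)) :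
z(c_0) = 1, M_V(z) ⪰ 0}`"; here: `conv X_{2^n} = π(S^{2n−1}_+ ∩ L)` for some affine `L` and linear
`π`, through FGPRT Thm. 3.3 `IsConvexPolygon.hasPsdLift_iff`; equivariance not recorded), `n ≥ 2`.
An exponential gap with the number `2^n` of vertices; the tree's lower bound for all `m`-gons,
`m ≥ 5`, is `4` (`IsConvexPolygon.four_le_of_hasPsdLift`). [cite: FawziSaundersonParrilo2014, §3.2 eq. (lift2) (p13)] -/
theorem _root_.Literature.Combinatorics.Optimization.FawziSaundersonParrilo2014_lift {n : ℕ} (hn : 2 ≤ n) :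
    HasPsdLift (convexHull ℝ (Set.range (vertex (2 ^ n)))) (2 * n - 1) := by
  have h3 : 3 ≤ 2 ^ n :=
    le_trans (by norm_num) (Nat.pow_le_pow_right (by norm_num) hn : 2 ^ 2 ≤ 2 ^ n)
  exact ((isConvexPolygon_vertex h3).hasPsdLift_iff h3 (by omega)).mpr
    (hasPsdFactorization_polygonSlack_vertex (by omega))

/-- The same lift for the facet description `{p : ⟨u_j, p⟩ ≤ cos(π/2^n) ∀ j}` of the regular `2^n`-gon.
[cite: FawziSaundersonParrilo2014, §3.2 eq. (lift2) (p13)] -/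
theorem hasPsdLift_polygon {n : ℕ} (hn : 2 ≤ n) : HasPsdLift (polygon (2 ^ n)) (2 * n - 1) := by
  have h3 : 3 ≤ 2 ^ n :=
    le_trans (by norm_num) (Nat.pow_le_pow_right (by norm_num) hn : 2 ^ 2 ≤ 2 ^ n)
  rw [polygon_eq_convexHull h3]
  exact FawziSaundersonParrilo2014_lift hn

/-- **The regular octagon**: `4 ≤ rank_psd S_8 ≤ 5` — the slack matrix of the regular `8`-gon has a
psd factorization of size `5 = 2·3 − 1` (FSP) and none of size `3` (GRT 2013 Thm. 4.7,
`IsConvexPolygon.four_le_of_hasPsdFactorization`); GRT *Worst-case results* §3 (p07): "We know some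
`8`-gons with psd rank four, but we have no idea how high their psd rank can be, apart from the
trivial upper bound of six". The EXACT value is `4` (Vandaele–Glineur–Gillis 2018, Ex. 5.2, a
non-equivariant `S^4_+`-factorization): `RegularPolygon.regularOctagon_psdRank_four` in
`RegularOctagonPsdRankFour.lean`. [cite: FawziSaundersonParrilo2014, §3.2 (p13) and Table 1 (p04)] -/
theorem regularOctagon_psdRank_bounds :
    HasPsdFactorization (polygonSlack (vertex (2 ^ 3))) 5 ∧
      ¬ HasPsdFactorization (polygonSlack (vertex (2 ^ 3))) 3 :=
  ⟨hasPsdFactorization_polygonSlack_vertex (n := 3) (by norm_num),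
    (isConvexPolygon_vertex (N := 2 ^ 3) (by norm_num)).not_hasPsdFactorization_three (by norm_num)⟩

/-- **The regular `16`-gon** has `4 ≤ rank_psd ≤ 7` (the `7 × 7` linear matrix inequality displayed
on p13). [cite: FawziSaundersonParrilo2014, §3.2 (p13, the `16`-gon)] -/
theorem regularHexadecagon_psdRank_bounds :
    HasPsdFactorization (polygonSlack (vertex (2 ^ 4))) 7 ∧
      ¬ HasPsdFactorization (polygonSlack (vertex (2 ^ 4))) 3 :=
  ⟨hasPsdFactorization_polygonSlack_vertex (n := 4) (by norm_num),
    (isConvexPolygon_vertex (N := 2 ^ 4) (by norm_num)).not_hasPsdFactorization_three (by norm_num)⟩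

/-- Lift form of the gap: for `n ≥ 3` the regular `2^n`-gon has a psd lift of size `2n − 1` and every
psd lift of it has size `≥ 4`. [cite: FawziSaundersonParrilo2014, §3.2 (p13) and Table 1 (p04)] -/
theorem hasPsdLift_bounds {n : ℕ} (hn : 3 ≤ n) :
    HasPsdLift (convexHull ℝ (Set.range (vertex (2 ^ n)))) (2 * n - 1) ∧
      ∀ k, HasPsdLift (convexHull ℝ (Set.range (vertex (2 ^ n)))) k → 4 ≤ k := by
  have h5 : 5 ≤ 2 ^ n :=
    le_trans (by norm_num) (Nat.pow_le_pow_right (by norm_num) hn : 2 ^ 3 ≤ 2 ^ n)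
  exact ⟨FawziSaundersonParrilo2014_lift (by omega),
    fun k hk => (isConvexPolygon_vertex (by omega)).four_le_of_hasPsdLift h5 hk⟩

end Lifts

/-! ### Theorem 3: the explicit `(S^3_+)^{n-1}`-description of the regular `2^n`-gon -/

section LiftSet

/-- **The lifted set of FSP Theorem 3** (p05, verbatim): "the set of points `(x_0, y_0) ∈ ℝ²` such
that there exist real numbers `x_1, y_1, …, x_{n−2}, y_{n−2}, y_{n−1}` satisfying `[1, x_{k−1},
y_{k−1}; x_{k−1}, (1+x_k)/2, y_k/2; y_{k−1}, y_k/2, (1−x_k)/2] ∈ S^3_+` for `k = 1, …, n−2` and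
`[1, x_{n−2}, y_{n−2}; x_{n−2}, 1/2, y_{n−1}/2; y_{n−2}, y_{n−1}/2, 1/2] ∈ S^3_+`" — typed with
sequences `x, y : ℕ → ℝ`, the blocks `fspBlock (x k) (y k) (x (k+1)) (y (k+1))` for `k + 1 < n`, and
the convention `x_{n−1} = 0` for the last block. [cite: FawziSaundersonParrilo2014, Thm. 3 (p05) and eq. (lift1) (p13)] -/
def fspLiftSet (n : ℕ) : Set (Fin 2 → ℝ) :=
  {p | ∃ x y : ℕ → ℝ, x 0 = p 0 ∧ y 0 = p 1 ∧ x (n - 1) = 0 ∧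
    ∀ k, k + 1 < n → (fspBlock (x k) (y k) (x (k + 1)) (y (k + 1))).PosSemidef}

/-- The lifted set is convex (it is a linear image of a spectrahedron; the blocks are affine in the
variables). [cite: FawziSaundersonParrilo2014, Thm. 3 (p05)] -/
theorem convex_fspLiftSet (n : ℕ) : Convex ℝ (fspLiftSet n) := by
  rintro p ⟨x, y, hx0, hy0, hxl, hB⟩ p' ⟨x', y', hx0', hy0', hxl', hB'⟩ α β hα hβ hαβ
  refine ⟨fun k => α * x k + β * x' k, fun k => α * y k + β * y' k, ?_, ?_, ?_, fun k hk => ?_⟩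
  · simp [hx0, hx0']
  · simp [hy0, hy0']
  · simp [hxl, hxl']
  · rw [← fspBlock_convex_comb _ _ _ _ _ _ _ _ α β hαβ]
    exact ((hB k hk).smul hα).add ((hB' k hk).smul hβ)

/-- **The vertices lie in the lifted set**, with the moments `x_k = cos(2^k θ_i)`, `y_k = sin(2^k θ_i)`
(`x_{n−1} = c_{2^{n−1}}(θ_i) = 0`; the blocks are the rank-one moment matrices).
[cite: FawziSaundersonParrilo2014, Thm. 6 (p07) and §3.1 (p13, "`x_k, y_k` correspond to `z(c_{2^k}), z(s_{2^k})`")] -/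
theorem vertex_mem_fspLiftSet {n : ℕ} (hn : 1 ≤ n) (i : Fin (2 ^ n)) : vertex (2 ^ n) i ∈ fspLiftSet n := by
  have h0 : facetAngle (2 ^ n) 0 = 0 := by simp [facetAngle]
  refine ⟨fun k => cos (2 ^ k * vertexAngle (2 ^ n) i), fun k => sin (2 ^ k * vertexAngle (2 ^ n) i),
    by simp [vertex], by simp [vertex], ?_, fun k _ => ?_⟩
  · simpa [h0] using cos_pow_pred_mul_angle_sub hn i 0
  · simp only [pow_succ, show (2:ℝ) ^ k * 2 * vertexAngle (2 ^ n) i = 2 * (2 ^ k * vertexAngle (2 ^ n) i) by ring]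
    exact posSemidef_fspBlock_moment _

/-- `conv X_{2^n} ⊆` the lifted set. [cite: FawziSaundersonParrilo2014, Thm. 3 (p05)] -/
theorem convexHull_subset_fspLiftSet {n : ℕ} (hn : 1 ≤ n) :
    convexHull ℝ (Set.range (vertex (2 ^ n))) ⊆ fspLiftSet n :=
  convexHull_min (by rintro _ ⟨i, rfl⟩; exact vertex_mem_fspLiftSet hn i) (convex_fspLiftSet n)

/-- **The lifted set satisfies every facet inequality** — the linear identity behind Theorem 3: for a
feasible `(x, y)` and the facet `φ = φ_j`, `cos(π/2^n) − ⟨u_j, p⟩ = Σ_{k ≤ n−2} w_k q_kᵀ B_k q_k ≥ 0`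
with `q_k = (cos(2^kπ/2^n), −cos(2^kφ), −sin(2^kφ))` (the certificate of Prop. 8 rotated to the facet,
paired with the blocks; the tail `L_{n−1} = cos(jπ)·x_{n−1} + sin(jπ)·y_{n−1}` vanishes).
[cite: FawziSaundersonParrilo2014, Thm. 3 (p05) via Thm. 6 (p07) and Prop. 8 (p12)] -/
theorem fspLiftSet_subset_polygon {n : ℕ} (hn : 1 ≤ n) : fspLiftSet n ⊆ polygon (2 ^ n) := by
  rintro p ⟨x, y, hx0, hy0, hxl, hB⟩ j
  set φ := facetAngle (2 ^ n) j
  let L : ℕ → ℝ := fun k => cos (2 ^ k * φ) * x k + sin (2 ^ k * φ) * y k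
  have hsum := sum_weight_affine hn L
  have hL0 : L 0 = normal (2 ^ n) j ⬝ᵥ p := by
    rw [normal_dotProduct]
    simp [L, hx0, hy0, φ]
  have hLl : L (n - 1) = 0 := by
    have : sin (2 ^ (n - 1) * φ) = 0 := by
      have h2 : (2:ℝ) ^ n = 2 * 2 ^ (n - 1) := by
        obtain ⟨m, rfl⟩ := Nat.exists_eq_add_of_le hn
        simp [pow_add]
      have : 2 ^ (n - 1) * φ = (j : ℕ) * π := by
        simp only [φ, facetAngle, Nat.cast_pow, Nat.cast_ofNat, h2]
        field_simp
      rw [this, sin_nat_mul_pi]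
    simp [L, hxl, this]
  have hnonneg : ∀ k ∈ Finset.range (n - 1),
      0 ≤ weight n k * (level n k ^ 2 + 1 / 2 - 2 * level n k * L k + L (k + 1) / 2) := by
    intro k hk
    have hk' : k + 2 ≤ n := by have := Finset.mem_range.mp hk; omega
    refine mul_nonneg (weight_pos hk').le ?_
    have hq := (hB k (by omega)).dotProduct_mulVec_nonneg ![level n k, -cos (2 ^ k * φ), -sin (2 ^ k * φ)]
    rw [star_trivial, fspBlock_quadForm] at hq
    convert hq using 1
    simp only [L, pow_succ, show (2:ℝ) ^ k * 2 * φ = 2 * (2 ^ k * φ) by ring]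
  have h := Finset.sum_nonneg hnonneg
  rw [hsum, hLl, mul_zero, add_zero, hL0, sub_nonneg, ← pi_div_pow_two] at h
  exact h

/-- **FSP Theorem 3** (p05, verbatim): "The regular `2^n`-gon is the set of points `(x_0,y_0) ∈ ℝ²`
such that there exist real numbers `x_1, y_1, …, x_{n−2}, y_{n−2}, y_{n−1}` satisfying" the `n − 1`
linear matrix inequalities of `fspLiftSet` — an explicit `(S^3_+)^{n−1}`-lift with rational data
(`n ≥ 2`; here the `2^n`-gon as `conv X_{2^n}`). [cite: FawziSaundersonParrilo2014, Thm. 3 (p05) and eq. (lift1) (p13)] -/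
theorem _root_.Literature.Combinatorics.Optimization.FawziSaundersonParrilo2014_thm3 {n : ℕ} (hn : 2 ≤ n) :
    convexHull ℝ (Set.range (vertex (2 ^ n))) = fspLiftSet n := by
  have h3 : 3 ≤ 2 ^ n :=
    le_trans (by norm_num) (Nat.pow_le_pow_right (by norm_num) hn : 2 ^ 2 ≤ 2 ^ n)
  refine Set.Subset.antisymm (convexHull_subset_fspLiftSet (by omega)) ?_
  rw [← polygon_eq_convexHull h3]
  exact fspLiftSet_subset_polygon (by omega)

/-- Theorem 3 for the facet description: `{p : ⟨u_j, p⟩ ≤ cos(π/2^n) ∀ j} = fspLiftSet n` (`n ≥ 2`).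
[cite: FawziSaundersonParrilo2014, Thm. 3 (p05)] -/
theorem polygon_eq_fspLiftSet {n : ℕ} (hn : 2 ≤ n) : polygon (2 ^ n) = fspLiftSet n := by
  have h3 : 3 ≤ 2 ^ n :=
    le_trans (by norm_num) (Nat.pow_le_pow_right (by norm_num) hn : 2 ^ 2 ≤ 2 ^ n)
  rw [polygon_eq_convexHull h3, FawziSaundersonParrilo2014_thm3 hn]

end LiftSet


end RegularPolygon
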